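import Summits.BirchSwinnertonDyer.BirchSwinnertonDyer.Theorems.BiquadraticEisensteinDescentHeegnerTwistCouplingInSupplyQuarticPlusThreeDescent
import Summits.BirchSwinnertonDyer.BirchSwinnertonDyer.Theorems.BiquadraticEisensteinDescentHeegnerTwistCouplingInSupplyQuarticMinusTripleCorner
import Summits.BirchSwinnertonDyer.BirchSwinnertonDyer.Theorems.BiquadraticEisensteinDescentHeegnerTwistCouplingInSupplyQuarticCornerAllP
import HarnessLib

set_option linter.dupNamespace false -- `Summit.BirchSwinnertonDyer.BirchSwinnertonDyer.Theorems.…` (summit = sub)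
set_option autoImplicit false

/-!
# Crux `HeegnerTwistCouplingInSupply` (stmt-BirchSwinnertonDyer-21381) — the QUARTIC `j = 1728` corner `X_p : y² = x³ + p·x` at `p ≡ 3 (mod 16)`:
# ★★ the generic pair rung `cruxOnQuarticPlusThreeCornerPair_of_BT`, modulo Burungale–Tian ONLY

Route `BiquadraticEisensteinDescent` (cell `pub/bsd-wall`, width seat `bsd-wall-cm-bed-w4` g14; `--supports` 21381, helper). Assembly of
`…QuarticPlusThreeDescent` (both Selmer sets of `X_p^{(−rt)} : y² = x³ + r²t²p·x` have two elements, for primes `r ≡ 1`, `t ≡ 7 (mod 8)` with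
`(r/p) = −1`, `(t/p) = +1`, `p ≡ 3 (mod 16)`): §1 `rank = 0 ∧ Ш[2] = 0 ∧ corank_{ℤ₂} Sel_{2^∞} = 0` (UNCONDITIONAL) and `L(1) ≠ 0` modulo Burungale–Tian
ONLY (`j = 1728` ⇒ CM; continuation = tree theorem `QuarticTwist.hasEntireLFunction`, `r²t²p` fourth-power-free); §2 the witness field `K′ = ℚ(√−rt)`
(`−rt ≡ 1 (mod 8)`, `(−rt/p) = +1`: Heegner for `N(X_p)`, prime support `{2, p}` by bed-w4 g13's `eq_two_or_eq_of_prime_dvd_conductorNorm_Wplus`);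
§3 ★★ `cruxOnQuarticPlusThreeCornerPair_of_BT`: for every prime `p ≡ 3 (mod 16)` and every such pair with `h(−rt) < p`, the CONCLUSION of crux 21381
for `W = X_p`; §4 the binders of the literal (`isElliptic_Wplus`, `isGloballyMinimal_Wplus` from `…QuarticCornerAllP.isGloballyMinimal_Xpow`) and
`eq_of_not_good_Wplus`. First corner theorem on the class `p ≡ 3 (mod 16)`; `…QuarticPlusThreeRows` supplies pairs `(r, t)` below `6000`.

HONEST FRAMING: a typed sub-corner on ONE CM family (measure zero in «all CM `W`»); no pin bounds the least `(1,−)`- or `(7,+)`-prime, so this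
rung is not an all-`p` theorem; the crux (residual C⁺) is untouched; BSD is not proved by any of this. THEOREMS ONLY. Supports stmt-BirchSwinnertonDyer-21381.
-/

noncomputable section

open scoped Classical NumberField

namespace Summit.BirchSwinnertonDyer.BirchSwinnertonDyer.Theorems.BiquadraticEisensteinDescentHeegnerTwistCouplingInSupplyQuarticPlusThreeCorner

open _root_.WeierstrassCurve Literature.NumberTheory.EllipticCurves Literature.NumberTheory.EllipticCurves.XCubeAddPX
open Literature.NumberTheory.QuadraticFields Literature.NumberTheory.QuadraticFields.Quadratic
open IsDedekindDomain Rat.HeightOneSpectrum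
open Summit.BirchSwinnertonDyer.BirchSwinnertonDyer.Theorems.BiquadraticEisensteinDescentHeegnerTwistCouplingInSupplyQuarticTwistLocal
open Summit.BirchSwinnertonDyer.BirchSwinnertonDyer.Theorems.BiquadraticEisensteinDescentHeegnerTwistCouplingInSupplyQuarticTwistCorner
  (j_and_hasCM_lit lit_eq)
open Summit.BirchSwinnertonDyer.BirchSwinnertonDyer.Theorems.BiquadraticEisensteinDescentHeegnerTwistCouplingInSupplyQuarticPlusCorner
  (quadraticTwist_Wplus eq_two_or_eq_of_prime_dvd_conductorNorm_Wplus hasGoodReductionAtPrime_Wplus not_isSquare_of_jacobiSym_eq_neg_one)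
open Summit.BirchSwinnertonDyer.BirchSwinnertonDyer.Theorems.BiquadraticEisensteinDescentHeegnerTwistCouplingInSupplyQuarticPlusThreeDescent
  (mem_selmer_pos_iff_plusThree mem_selmer_neg_iff_plusThree)
open Summit.BirchSwinnertonDyer.BirchSwinnertonDyer.Theorems.BiquadraticEisensteinDescentHeegnerTwistCouplingInSupplyQuarticMinusTripleCorner
  (not_isSquare_mod_of_jacobiSym_eq_neg_one)
open Summit.BirchSwinnertonDyer.BirchSwinnertonDyer.Theorems.BiquadraticEisensteinDescentHeegnerTwistCouplingInSupplyQuarticCornerAllP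
  (isGloballyMinimal_Xpow)

/-! ## §1 The twist `E = X_p^{(−rt)} : y² = x³ + r²t²p·x` -/

section Twist

variable {p r t : ℕ} [hp : Fact p.Prime] [hr : Fact r.Prime] [ht : Fact t.Prime]

/-- **Both Selmer sets have two elements**: `S(0, r²t²p) = {1, p}`, `S′ = S(0, −4r²t²p) = {1, −p}`, so `dim₂ S = dim₂ S′ = 1`.
[cite: SilvermanAEC2009, Prop. X.4.9 and Prop. X.6.1] -/
theorem twoIsogenySelmerRank_plusThree (hp16 : p % 16 = 3) (hr8 : r % 8 = 1) (ht8 : t % 8 = 7)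
    (hpr : ¬ IsSquare ((p : ℤ) : ZMod r)) (hpt : ¬ IsSquare ((p : ℤ) : ZMod t)) :
    twoIsogenySelmerRank 0 (r ^ 2 * t ^ 2 * p : ℤ) = 1 ∧ twoIsogenySelmerRank' 0 (r ^ 2 * t ^ 2 * p : ℤ) = 1 := by
  have hP := hp.out
  have h1p : (1 : ℤ) ≠ (p : ℤ) := by exact_mod_cast hP.one_lt.ne
  have h1p' : (1 : ℤ) ≠ -(p : ℤ) := by have := hP.one_lt; omega
  have hS : twoIsogenySelmerGroup 0 (r ^ 2 * t ^ 2 * p : ℤ) = {1, (p : ℤ)} := by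
    ext d
    rw [mem_selmer_pos_iff_plusThree hp16 hr8 ht8 hpr hpt, Finset.mem_insert, Finset.mem_singleton]
  have hS' : twoIsogenySelmerGroup' 0 (r ^ 2 * t ^ 2 * p : ℤ) = {1, -(p : ℤ)} := by
    rw [twoIsogenySelmerGroup'_eq, show (-2 * 0 : ℤ) = 0 by norm_num,
      show ((0 : ℤ) ^ 2 - 4 * (r ^ 2 * t ^ 2 * p : ℤ)) = -(4 * r ^ 2 * t ^ 2 * p) by ring]
    ext d
    rw [mem_selmer_neg_iff_plusThree hp16 hr8 ht8 hpr hpt, Finset.mem_insert, Finset.mem_singleton]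
  refine ⟨?_, ?_⟩
  · rw [twoIsogenySelmerRank, hS, Finset.card_pair h1p]
    exact Nat.log_pow Nat.one_lt_two 1
  · rw [twoIsogenySelmerRank'_eq, hS', Finset.card_pair h1p']
    exact Nat.log_pow Nat.one_lt_two 1

/-- ★ **`rank = 0`, `Ш[2] = 0`, `corank_{ℤ₂} Sel_{2^∞} = 0` for `E : y² = x³ + r²t²p·x`** in the pair cell — UNCONDITIONAL.
[cite: SilvermanAEC2009, Prop. X.4.7 and Thm. X.4.2(a); Prop. X.6.1] [cite: Greenberg1999LNM, §1 pp. 54–57] -/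
theorem rank_sha_corank_plusThree (hp16 : p % 16 = 3) (hr8 : r % 8 = 1) (ht8 : t % 8 = 7)
    (hpr : ¬ IsSquare ((p : ℤ) : ZMod r)) (hpt : ¬ IsSquare ((p : ℤ) : ZMod t))
    [hE : (⟨0, ((0 : ℤ) : ℚ), 0, ((r ^ 2 * t ^ 2 * p : ℤ) : ℚ), 0⟩ : WeierstrassCurve ℚ).IsElliptic] :
    (⟨0, ((0 : ℤ) : ℚ), 0, ((r ^ 2 * t ^ 2 * p : ℤ) : ℚ), 0⟩ : WeierstrassCurve ℚ).mordellWeilRank = 0 ∧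
    (∀ c ∈ (⟨0, ((0 : ℤ) : ℚ), 0, ((r ^ 2 * t ^ 2 * p : ℤ) : ℚ), 0⟩ : WeierstrassCurve ℚ).sha, 2 • c = 0 → c = 0) ∧
    (⟨0, ((0 : ℤ) : ℚ), 0, ((r ^ 2 * t ^ 2 * p : ℤ) : ℚ), 0⟩ : WeierstrassCurve ℚ).selmerCorank 2 = 0 := by
  have hP := hp.out
  have hp0 : (p : ℤ) ≠ 0 := by exact_mod_cast hP.ne_zero
  have hr0 : (r : ℤ) ≠ 0 := by exact_mod_cast hr.out.ne_zero
  have ht0 : (t : ℤ) ≠ 0 := by exact_mod_cast ht.out.ne_zero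
  have hb : (r ^ 2 * t ^ 2 * p : ℤ) ≠ 0 := mul_ne_zero (mul_ne_zero (pow_ne_zero 2 hr0) (pow_ne_zero 2 ht0)) hp0
  have hab : (r ^ 2 * t ^ 2 * p : ℤ) * ((0 : ℤ) ^ 2 - 4 * (r ^ 2 * t ^ 2 * p : ℤ)) ≠ 0 := by
    refine mul_ne_zero hb ?_
    rw [show ((0 : ℤ) ^ 2 - 4 * (r ^ 2 * t ^ 2 * p : ℤ)) = -(4 * (r ^ 2 * t ^ 2 * p)) by ring]
    exact neg_ne_zero.mpr (mul_ne_zero (by norm_num) hb)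
  haveI := isElliptic_halfModel hab
  obtain ⟨h1, h2⟩ := twoIsogenySelmerRank_plusThree hp16 hr8 ht8 hpr hpt
  have hle : twoIsogenySelmerRank 0 (r ^ 2 * t ^ 2 * p : ℤ) + twoIsogenySelmerRank' 0 (r ^ 2 * t ^ 2 * p : ℤ) ≤
      (⟨0, ((0 : ℤ) : ℚ), 0, ((r ^ 2 * t ^ 2 * p : ℤ) : ℚ), 0⟩ : WeierstrassCurve ℚ).mordellWeilRank + 2 := by
    rw [h1, h2]; omega
  obtain ⟨-, -, hsum⟩ := natCard_sha_inf_range_eq_one_of_selmerRank_add_le hab hle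
  have hrank : (⟨0, ((0 : ℤ) : ℚ), 0, ((r ^ 2 * t ^ 2 * p : ℤ) : ℚ), 0⟩ : WeierstrassCurve ℚ).mordellWeilRank = 0 := by
    rw [h1, h2] at hsum; omega
  have hsha := forall_mem_sha_two_smul_eq_zero_of_selmerRank_add_le hab hle
  haveI : Fact (Nat.Prime 2) := ⟨Nat.prime_two⟩
  refine ⟨hrank, hsha, ?_⟩
  rw [(⟨0, ((0 : ℤ) : ℚ), 0, ((r ^ 2 * t ^ 2 * p : ℤ) : ℚ), 0⟩ : WeierstrassCurve ℚ).selmerCorank_eq_mordellWeilRank_add_holds 2,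
    hrank, (⟨0, ((0 : ℤ) : ℚ), 0, ((r ^ 2 * t ^ 2 * p : ℤ) : ℚ), 0⟩ : WeierstrassCurve ℚ).shaCorank_eq_zero_of_forall 2 hsha]

omit hp hr ht in
/-- `b = r²t²p` (`r, t, p` distinct primes) is free of fourth powers. [folklore] -/
theorem not_pow_four_dvd_plusThree (hP : p.Prime) (hR : r.Prime) (hT : t.Prime) (hrp : r ≠ p) (htp : t ≠ p) (hrt : r ≠ t)
    (u : ℕ) (hu : u.Prime) : ¬ (u : ℤ) ^ 4 ∣ (r ^ 2 * t ^ 2 * p : ℤ) := by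
  intro h
  have h' : u ^ 4 ∣ r ^ 2 * t ^ 2 * p ^ 1 := by
    have := Int.natAbs_dvd_natAbs.mpr h
    simpa [Int.natAbs_mul, Int.natAbs_pow] using this
  have hcop : ∀ {a b : ℕ} (m n : ℕ), a.Prime → b.Prime → a ≠ b → Nat.Coprime (a ^ m) (b ^ n) := fun m n ha hb hab =>
    Nat.Coprime.pow m n ((Nat.coprime_primes ha hb).mpr hab)
  by_cases hur : u = r
  · subst hur
    have h1 : u ^ 4 ∣ u ^ 2 := by
      rw [show u ^ 2 * t ^ 2 * p ^ 1 = u ^ 2 * (t ^ 2 * p ^ 1) by ring] at h'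
      exact ((hcop 4 2 hR hT hrt).mul_right (hcop 4 1 hR hP hrp)).dvd_of_dvd_mul_right h'
    have := (Nat.pow_dvd_pow_iff_le_right hR.one_lt).mp h1
    omega
  by_cases hut : u = t
  · subst hut
    have h1 : u ^ 4 ∣ u ^ 2 := by
      rw [show r ^ 2 * u ^ 2 * p ^ 1 = u ^ 2 * (r ^ 2 * p ^ 1) by ring] at h'
      exact ((hcop 4 2 hT hR (Ne.symm hrt)).mul_right (hcop 4 1 hT hP htp)).dvd_of_dvd_mul_right h'
    have := (Nat.pow_dvd_pow_iff_le_right hT.one_lt).mp h1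
    omega
  by_cases hup : u = p
  · subst hup
    have h1 : u ^ 4 ∣ u ^ 1 := by
      rw [show r ^ 2 * t ^ 2 * u ^ 1 = u ^ 1 * (r ^ 2 * t ^ 2) by ring] at h'
      exact ((hcop 4 2 hP hR (Ne.symm hrp)).mul_right (hcop 4 2 hP hT (Ne.symm htp))).dvd_of_dvd_mul_right h'
    have := (Nat.pow_dvd_pow_iff_le_right hP.one_lt).mp h1
    omega
  · have hc : Nat.Coprime (u ^ 4) (r ^ 2 * t ^ 2 * p ^ 1) :=
      ((hcop 4 2 hu hR hur).mul_right (hcop 4 2 hu hT hut)).mul_right (hcop 4 1 hu hP hup)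
    have h1 : u ^ 4 ∣ 1 := hc.dvd_of_dvd_mul_right (by simpa using h')
    have := Nat.le_of_dvd one_pos h1
    have := Nat.one_lt_pow (n := 4) (by norm_num) hu.one_lt
    omega

/-- ★ **`L`-form, ONE named fact**: `r_an(E) = 0` and `L(E, 1) ≠ 0` for `E : y² = x³ + r²t²p·x` in the pair cell, modulo Burungale–Tian ONLY
(continuation = `QuarticTwist.hasEntireLFunction`). [cite: BurungaleTian2026, Thm. 1.1] [cite: IrelandRosen1990, Ch. 18 §6 Theorem 7] -/
theorem L_one_ne_zero_plusThree_of_BT (hBT : burungaleTian_analyticRank_eq_zero_of_selmerCorank_eq_zero_of_hasCM)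
    (hp16 : p % 16 = 3) (hr8 : r % 8 = 1) (ht8 : t % 8 = 7)
    (hpr : ¬ IsSquare ((p : ℤ) : ZMod r)) (hpt : ¬ IsSquare ((p : ℤ) : ZMod t))
    [hE : (⟨0, ((0 : ℤ) : ℚ), 0, ((r ^ 2 * t ^ 2 * p : ℤ) : ℚ), 0⟩ : WeierstrassCurve ℚ).IsElliptic] :
    (⟨0, ((0 : ℤ) : ℚ), 0, ((r ^ 2 * t ^ 2 * p : ℤ) : ℚ), 0⟩ : WeierstrassCurve ℚ).analyticRank = 0 ∧
    (⟨0, ((0 : ℤ) : ℚ), 0, ((r ^ 2 * t ^ 2 * p : ℤ) : ℚ), 0⟩ : WeierstrassCurve ℚ).entireLFunction 1 ≠ 0 := by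
  haveI : Fact (Nat.Prime 2) := ⟨Nat.prime_two⟩
  have hP := hp.out
  have hR := hr.out
  have hT := ht.out
  have hb : (r ^ 2 * t ^ 2 * p : ℤ) ≠ 0 := mul_ne_zero (mul_ne_zero (pow_ne_zero 2 (by exact_mod_cast hR.ne_zero))
    (pow_ne_zero 2 (by exact_mod_cast hT.ne_zero))) (by exact_mod_cast hP.ne_zero)
  obtain ⟨-, hCM⟩ := j_and_hasCM_lit hb
  obtain ⟨-, -, hcor⟩ := rank_sha_corank_plusThree hp16 hr8 ht8 hpr hpt
  have h0 := hBT _ hCM 2 hcor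
  have h4 := not_pow_four_dvd_plusThree hP hR hT (by rintro rfl; omega) (by rintro rfl; omega) (by rintro rfl; omega)
  have hH := QuarticTwist.hasEntireLFunction hb h4
  rw [← lit_eq] at hH
  exact ⟨h0, (analyticRank_eq_zero_iff_holds
    (W := (⟨0, ((0 : ℤ) : ℚ), 0, ((r ^ 2 * t ^ 2 * p : ℤ) : ℚ), 0⟩ : WeierstrassCurve ℚ)) hH).1 h0⟩

end Twist

/-! ## §2 Symbols and the witness field `K′ = ℚ(√−rt)` -/

section Field

/-- `(−rt/p) = +1` in the pair cell: `p ≡ 3 (mod 4)`, `(r/p) = −1`, `(t/p) = +1`. [folklore] -/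
theorem jacobiSym_neg_pair_eq_one {p r t : ℕ} (hp4 : p % 4 = 3) (hJr : jacobiSym (r : ℤ) p = -1)
    (hJt : jacobiSym (t : ℤ) p = 1) : jacobiSym (-((r * t : ℕ) : ℤ)) p = 1 := by
  have hm1 : jacobiSym (-1) p = -1 := DeuringLadic.jacobiSym_neg_one_of_mod_four hp4
  have : (-((r * t : ℕ) : ℤ)) = (-1) * (r : ℤ) * (t : ℤ) := by push_cast; ring
  rw [this, jacobiSym.mul_left, jacobiSym.mul_left, hm1, hJr, hJt]
  norm_num

/-- From `(t/p) = +1` with `p, t ≡ 3 (mod 4)` primes: `p` is a non-residue mod `t` (`(p/t) = −(t/p)`). [folklore] -/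
theorem not_isSquare_mod_of_jacobiSym_eq_one_three_mod_four {p t : ℕ} [Fact t.Prime] (hp4 : p % 4 = 3) (ht4 : t % 4 = 3)
    (hJ : jacobiSym (t : ℤ) p = 1) : ¬ IsSquare ((p : ℤ) : ZMod t) := by
  have h : jacobiSym (p : ℤ) t = -1 := by
    rw [jacobiSym.quadratic_reciprocity_three_mod_four hp4 ht4, hJ]
  exact not_isSquare_of_jacobiSym_eq_neg_one h

/-- **The witness field of the pair cell.** For primes `r ≡ 1`, `t ≡ 7 (mod 8)` and a prime `p` with `(−rt/p) = +1`, given any bound `h(·) < p`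
valid for every imaginary quadratic field of discriminant `−rt`: `K′ = ℚ(√−rt)` is imaginary quadratic, `d_{K′} = −rt ≡ 1 (mod 8)` (so `2` splits),
Heegner for every level whose prime divisors lie in `{2, p}`, and `h(K′) < p`. [cite: Marcus2018, Ch. 2 Thm. 1; Ch. 3 Thm. 25] -/
theorem exists_witnessField_pair {p r t : ℕ} (hr : r.Prime) (hr8 : r % 8 = 1) (ht : t.Prime) (ht8 : t % 8 = 7)
    (hJ : jacobiSym (-((r * t : ℕ) : ℤ)) p = 1)
    (hh : ∀ (K : Type) [Field K] [NumberField K], IsImaginaryQuadratic K →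
      NumberField.discr K = -((r * t : ℕ) : ℤ) → NumberField.classNumber K < p)
    {N : ℕ} (hN : ∀ u : ℕ, u.Prime → u ∣ N → u = 2 ∨ u = p) :
    ∃ (K : Type) (_ : Field K) (_ : NumberField K),
      IsImaginaryQuadratic K ∧ NumberField.discr K = -((r * t : ℕ) : ℤ) ∧
      SatisfiesHeegnerHypothesis N K ∧ NumberField.classNumber K < p := by
  have hrt : r ≠ t := by rintro rfl; omega
  haveI : Fact ((-((r * t : ℕ) : ℤ)) < 0) := ⟨by have := hr.two_le; have := ht.two_le; push_cast; nlinarith⟩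
  have hsf : Squarefree (-((r * t : ℕ) : ℤ)).natAbs := by
    rw [Int.natAbs_neg, Int.natAbs_natCast, Nat.squarefree_mul ((Nat.coprime_primes hr ht).mpr hrt)]
    exact ⟨hr.squarefree, ht.squarefree⟩
  have hD8 : (-((r * t : ℕ) : ℤ)) % 8 = 1 := by
    have : (r * t) % 8 = 7 := by rw [Nat.mul_mod, hr8, ht8]
    omega
  obtain ⟨hK, hdK⟩ := isImaginaryQuadratic_and_discr_sqrtField_of_squarefree_natAbs (-((r * t : ℕ) : ℤ)) (by omega) hsf
  refine ⟨sqrtField (-((r * t : ℕ) : ℤ)), inferInstance, inferInstance, hK, hdK, ?_, hh _ hK hdK⟩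
  refine satisfiesHeegnerHypothesis_sqrtField_of_squarefree_natAbs _ hD8 hsf fun u hu huN => ?_
  rcases hN u hu huN with rfl | rfl
  · exact Or.inl rfl
  · exact Or.inr hJ

end Field

/-! ## §3 ★★ The generic pair rung for `W = X_p`, `p ≡ 3 (mod 16)`, modulo Burungale–Tian only -/

section Corner

/-- The common final step: from the pair data `(r, t)` to the `L`-value of the twist by `−rt`. [folklore] -/
theorem L_twist_ne_zero_plusThree (hBT : burungaleTian_analyticRank_eq_zero_of_selmerCorank_eq_zero_of_hasCM) {p r t : ℕ}
    (hp : p.Prime) (hr : r.Prime) (ht : t.Prime) (hp16 : p % 16 = 3) (hr8 : r % 8 = 1) (ht8 : t % 8 = 7)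
    (hJr : jacobiSym (r : ℤ) p = -1) (hJt : jacobiSym (t : ℤ) p = 1) :
    ((⟨0, 0, 0, (p : ℚ), 0⟩ : WeierstrassCurve ℚ).quadraticTwist ((-((r * t : ℕ) : ℤ) : ℤ) : ℚ)).entireLFunction 1 ≠ 0 := by
  haveI := Fact.mk hp; haveI := Fact.mk hr; haveI := Fact.mk ht
  have hpr : ¬ IsSquare ((p : ℤ) : ZMod r) := not_isSquare_mod_of_jacobiSym_eq_neg_one (by omega) (by omega) hJr
  have hpt : ¬ IsSquare ((p : ℤ) : ZMod t) := not_isSquare_mod_of_jacobiSym_eq_one_three_mod_four (by omega) (by omega) hJt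
  rw [quadraticTwist_Wplus]
  rw [show ((-((r * t : ℕ) : ℤ)) ^ 2 * p : ℤ) = (r ^ 2 * t ^ 2 * p : ℤ) by push_cast; ring]
  have hb : (r ^ 2 * t ^ 2 * p : ℤ) ≠ 0 := mul_ne_zero (mul_ne_zero (pow_ne_zero 2 (by exact_mod_cast hr.ne_zero))
    (pow_ne_zero 2 (by exact_mod_cast ht.ne_zero))) (by exact_mod_cast hp.ne_zero)
  have hab : (r ^ 2 * t ^ 2 * p : ℤ) * ((0 : ℤ) ^ 2 - 4 * (r ^ 2 * t ^ 2 * p : ℤ)) ≠ 0 := by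
    refine mul_ne_zero hb ?_
    rw [show ((0 : ℤ) ^ 2 - 4 * (r ^ 2 * t ^ 2 * p : ℤ)) = -(4 * (r ^ 2 * t ^ 2 * p)) by ring]
    exact neg_ne_zero.mpr (mul_ne_zero (by norm_num) hb)
  haveI := isElliptic_mk_of_ne_zero (F := ℚ) hab
  exact (L_one_ne_zero_plusThree_of_BT hBT hp16 hr8 ht8 hpr hpt).2

/-- ★★ **THE PAIR RUNG FOR `W = X_p`, `p ≡ 3 (mod 16)`, ONE NAMED FACT.** For every prime `p ≡ 3 (mod 16)` and all primes `r ≡ 1`, `t ≡ 7 (mod 8)`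
with `(r/p) = −1`, `(t/p) = +1` and `h(K) < p` for every imaginary quadratic `K` of discriminant `−rt`: there is a Heegner field `K′ = ℚ(√−rt)` of
`N(X_p)` (`X_p : y² = x³ + p·x`; prime support `{2, p}`) with `4 < |d_{K′}|`, `L(X_p^{(d_{K′})}, 1) ≠ 0` (sharp `2`-isogeny descent of
`y² = x³ + r²t²p·x` — UNCONDITIONAL, Legendre-only — then Burungale–Tian at `2` and the PROVED continuation), `h(K′) < p` and `p ∤ h(K′)` — the
CONCLUSION of crux 21381 for `W = X_p`, modulo Burungale–Tian ONLY. [cite: BurungaleTian2026, Thm. 1.1]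
[cite: SilvermanAEC2009, Prop. X.4.9, Prop. X.4.7, Thm. X.4.2(a)] [cite: IrelandRosen1990, Ch. 18 §6 Theorem 7] -/
theorem cruxOnQuarticPlusThreeCornerPair_of_BT (hBT : burungaleTian_analyticRank_eq_zero_of_selmerCorank_eq_zero_of_hasCM) :
    ∀ (p : ℕ) [Fact p.Prime] [(⟨0, 0, 0, (p : ℚ), 0⟩ : WeierstrassCurve ℚ).IsElliptic]
      [(⟨0, 0, 0, (p : ℚ), 0⟩ : WeierstrassCurve ℚ).IsGloballyMinimal]
      [NeZero ((⟨0, 0, 0, (p : ℚ), 0⟩ : WeierstrassCurve ℚ).conductorNorm ℤ)],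
      p % 16 = 3 → ∀ r t : ℕ, r.Prime → t.Prime → r % 8 = 1 → t % 8 = 7 →
      jacobiSym (r : ℤ) p = -1 → jacobiSym (t : ℤ) p = 1 →
      (∀ (K : Type) [Field K] [NumberField K], IsImaginaryQuadratic K →
        NumberField.discr K = -((r * t : ℕ) : ℤ) → NumberField.classNumber K < p) →
      ∃ (K : Type) (_ : Field K) (_ : NumberField K),
        IsImaginaryQuadratic K ∧ 4 < (NumberField.discr K).natAbs ∧
        SatisfiesHeegnerHypothesis ((⟨0, 0, 0, (p : ℚ), 0⟩ : WeierstrassCurve ℚ).conductorNorm ℤ) K ∧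
        ((⟨0, 0, 0, (p : ℚ), 0⟩ : WeierstrassCurve ℚ).quadraticTwist (NumberField.discr K : ℚ)).entireLFunction 1 ≠ 0 ∧
        NumberField.classNumber K < p ∧ ¬ p ∣ NumberField.classNumber K := by
  intro p hpF _ _ _ hp16 r t hr ht hr8 ht8 hJr hJt hh
  have hp : p.Prime := hpF.out
  obtain ⟨K, iF, iN, hK, hdK, hH', hcl⟩ := exists_witnessField_pair (N := (⟨0, 0, 0, (p : ℚ), 0⟩ : WeierstrassCurve ℚ).conductorNorm ℤ)
    hr hr8 ht ht8 (jacobiSym_neg_pair_eq_one (by omega) hJr hJt) hh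
    (fun u hu huN => eq_two_or_eq_of_prime_dvd_conductorNorm_Wplus hp hu huN)
  refine ⟨K, iF, iN, hK, ?_, hH', ?_, hcl, fun hdvd => absurd (Nat.le_of_dvd (NumberField.classNumber_pos K) hdvd) (not_le.mpr hcl)⟩
  · rw [hdK, Int.natAbs_neg, Int.natAbs_natCast]
    have h9 : 9 ≤ r := by have := hr.two_le; omega
    have h7 : 7 ≤ t := by have := ht.two_le; omega
    calc 4 < 9 * 7 := by norm_num
      _ ≤ r * t := Nat.mul_le_mul h9 h7
  · rw [hdK]
    exact L_twist_ne_zero_plusThree hBT hp hr ht hp16 hr8 ht8 hJr hJt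

end Corner

/-! ## §4 The crux's instance binders for the literal `X_p` and its bad primes -/

section Binders

/-- **`X_p : y² = x³ + p·x` is an elliptic curve** (`p` prime). [folklore] -/
theorem isElliptic_Wplus (p : ℕ) [Fact p.Prime] : (⟨0, 0, 0, (p : ℚ), 0⟩ : WeierstrassCurve ℚ).IsElliptic := by
  have h := XCubeAddDX.isElliptic_xD (D := (p : ℤ)) (by exact_mod_cast (Fact.out : p.Prime).ne_zero)
  simpa only [Int.cast_natCast] using h

/-- **`X_p` (`p` an odd prime) is a global minimal model** (`…QuarticCornerAllP.isGloballyMinimal_Xpow` at `k = 1`).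
[cite: SilvermanAEC2009, VII.1 Remark 1.1] -/
theorem isGloballyMinimal_Wplus {p : ℕ} (hp : p.Prime) (hp2 : p ≠ 2) : (⟨0, 0, 0, (p : ℚ), 0⟩ : WeierstrassCurve ℚ).IsGloballyMinimal := by
  simpa only [pow_one] using isGloballyMinimal_Xpow hp hp2 (k := 1) (by omega)

/-- **The only bad prime `≥ 5` of `X_n` is `n`** (`n` prime). [cite: SilvermanAEC2009, VII.5 Prop. 5.1(a)] -/
theorem eq_of_not_good_Wplus {n p : ℕ} [Fact p.Prime] (hn : n.Prime) (h5 : 5 ≤ p)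
    (hbad : ¬ Literature.NumberTheory.EllipticCurves.Rank1Residual.Good (⟨0, 0, 0, (n : ℚ), 0⟩ : WeierstrassCurve ℚ) p) : p = n := by
  have hp : p.Prime := Fact.out
  by_contra hne
  refine hbad (hasGoodReductionAtPrime_Wplus fun hdvd => ?_)
  rcases (Nat.Prime.dvd_mul hp).mp hdvd with h2 | h
  · have := (Nat.prime_dvd_prime_iff_eq hp Nat.prime_two).mp h2
    omega
  · exact hne ((Nat.prime_dvd_prime_iff_eq hp hn).mp h)

end Binders

end Summit.BirchSwinnertonDyer.BirchSwinnertonDyer.Theorems.BiquadraticEisensteinDescentHeegnerTwistCouplingInSupplyQuarticPlusThreeCorner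

end
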